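import Summits.NavierStokesRegularity.NavierStokesRegularity.Theorems.PlaneEnergyCeilingPlanarEnergyLiouvilleOscillation
import Literature.Analysis.FluidPDE.KNSSLiouvillePlanarHolds
import Literature.Analysis.FluidPDE.AncientMildWeak
import Summits.NavierStokesRegularity.NavierStokesRegularity.Theorems.PlanarEnergyLiouville.Negative.PlanarBoundLoadBearing
import Summits.NavierStokesRegularity.NavierStokesRegularity.Theorems.GaldiLiouvilleGateParabolicGaldiLiouvilleStubLpsOfSobolev
import HarnessLib

/-!
# Route PlaneEnergyCeiling · crux `PlanarEnergyLiouville` — stub S2 `stub_lateQuietTimes`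
# (late quiet times are `A·R`-dense)

Theorems file for the registered stub `stub_lateQuietTimes` of the line
`Cruxes/PlanarEnergyLiouville/Lines/mean_dissipation_sieve.lean` of the crux item
stmt-NavierStokesRegularity-16856 (`Theses.PlaneEnergyCeiling.PlanarEnergyLiouville`); landed
`--supports` that item. Statement (verbatim from the skeleton): under the crux hypotheses (bounded
ancient mild solution, `ν = 1`, measurable slices, jointly smooth on `(−∞,0) × ℝ³`, planar kinetic
energies `≤ M`) and the mean local dissipation bound of stub S1
(`∫_T^{t₁}∫_{B_R(x₀)} ‖∇v‖² ≤ C₁R + δ(t₁ − T)` for `R ≥ R₁(δ)`), for every `η > 0` there are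
`A, R₀ > 0` such that for all `R ≥ R₀`, `x₀`, `t₁ < 0` some `τ ∈ [t₁ − AR, t₁]` has `‖v(τ,·)‖ ≤ η`
on `B(x₀, R)`.

Proof.
* `exists_ae_fderiv_bound` — KNSS 2009 §4 through the tree's PROVED regularity fact
  `KNSS2009_regularity_boundedWeak_ancient_holds` (with the bridge
  `IsBoundedAncientMildSolution.isBoundedWeakNSSolutionOn`): for a.e. `t < 0` the continuous slice
  `v(t)` equals `U(t) + b(t)` with `‖∇U‖ ≤ C`, so `‖∇v(t,·)‖ ≤ G` for a.e. `t`.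
* Chebyshev in time on the S1 bound for `B(x₀, 2R)` over `[t₁ − AR, t₁]` with `δ = ε/2`,
  `A = 4|C₁|/ε + 1` (the radius cancels), inside the KNSS-good set of times: a time `τ` with
  `∫_{B(x₀,2R)} ‖∇v(τ)‖² ≤ ε` and `‖∇v(τ)‖ ≤ G`.
* `norm_sub_average_le_of_energy` (file `…Oscillation`): `‖v(τ,x) − v̄‖ ≤ 3Gρ₀ + 2√(ε/ρ₀) = η/4`
  on `B(x₀, R)` for `ρ₀ = η/(24(G+1))`, `ε = ρ₀(η/16)²`.
* `norm_mean_le_of_planar`: the planar bound on the disc of radius `R` through `x₀` in the plane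
  `{x₂ = (x₀)₂}` (area `πR²`, where `‖v‖ ≥ ‖v̄‖ − η/4`) gives `‖v̄‖ ≤ η/4 + √(M/π)/R ≤ 3η/4` once
  `R ≥ 2√(M/π)/η + 1`.

References: KNSS 2009 (Acta Math. 203), §4; the line card `Lines/mean-dissipation-sieve.md`.
-/

noncomputable section

set_option linter.dupNamespace false -- nested layout Summit.<S>.<Sub>, Sub = S (D-0017)

open MeasureTheory Set Filter Metric Function Real
open _root_.Topology
open scoped ENNReal NNReal

namespace Summit.NavierStokesRegularity.NavierStokesRegularity.Theorems.PlaneEnergyCeilingPlanarEnergyLiouville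

open Literature.Analysis.FluidPDE
open Summit.NavierStokesRegularity.NavierStokesRegularity.Theorems.PlanarEnergyLiouvilleNegative
  (continuous_slice_of_contDiffOn)

/-- **KNSS gradient bound for the smooth representative, a.e. in time.** A bounded ancient mild
solution (`ν = 1`) with measurable slices which is jointly smooth on `(−∞,0) × ℝ³` has
`‖∇v(t, ·)‖ ≤ G` on `ℝ³` for a.e. `t < 0` (KNSS 2009 §4, through the tree's proved regularity fact
`KNSS2009_regularity_boundedWeak_ancient_holds`: `v(t) = U(t) + b(t)` a.e. in `x` for a.e. `t`,
with `‖∇U‖ ≤ C`; both sides being continuous, `v(t) = U(t) + b(t)` everywhere).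
[cite: KochNadirashviliSereginSverak2009, §4 (4.7)] -/
theorem exists_ae_fderiv_bound {v : ℝ → EuclideanSpace ℝ (Fin 3) → EuclideanSpace ℝ (Fin 3)}
    (hv : IsBoundedAncientMildSolution 1 v)
    (hmeas : ∀ t < 0, AEStronglyMeasurable (v t) volume)
    (hsm : ContDiffOn ℝ (⊤ : ℕ∞) (uncurry v) (Iio 0 ×ˢ univ)) :
    ∃ G : ℝ, 0 ≤ G ∧ ∀ᵐ t ∂((volume : Measure ℝ).restrict (Iio 0)),
      ∀ x, ‖fderiv ℝ (v t) x‖ ≤ G := by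
  have hjm : AEStronglyMeasurable (uncurry v)
      ((volume : Measure (ℝ × EuclideanSpace ℝ (Fin 3))).restrict (Iio 0 ×ˢ univ)) :=
    hsm.continuousOn.aestronglyMeasurable (measurableSet_Iio.prod MeasurableSet.univ)
  have hweak := hv.isBoundedWeakNSSolutionOn one_pos hjm hmeas
  obtain ⟨U, b, -, -, -, hrep, hsmooth, -, hbdd, -, -⟩ :=
    KNSS2009_regularity_boundedWeak_ancient_holds hweak
  obtain ⟨C, hC⟩ := hbdd 1
  refine ⟨max C 0, le_max_right _ _, ?_⟩
  filter_upwards [hrep, ae_restrict_mem measurableSet_Iio] with t ht htneg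
  intro x
  have hcont : Continuous (v t) := continuous_slice_of_contDiffOn hsm htneg
  have hcU : Continuous fun x => U t x + b t := (hsmooth t htneg).continuous.add continuous_const
  have heq : v t = fun x => U t x + b t := (Continuous.ae_eq_iff_eq volume hcont hcU).1 ht
  have hfd : fderiv ℝ (v t) x = fderiv ℝ (U t) x := by
    rw [heq]
    exact fderiv_add_const _
  rw [hfd, ← norm_iteratedFDeriv_one]
  exact (hC t htneg x).trans (le_max_left _ _)

/-- **The mean on a quiet ball is small (planar bound on the disc through the centre).** If
`‖f(x) − b̄‖ ≤ θ` on `B(x₀, R)` and the planar energy of `f` on the plane `{x₂ = (x₀)₂}` is `≤ M`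
(`0 ≤ M`), then `‖b̄‖ ≤ θ + √(M/π)/R` (on the disc of radius `R` of that plane,
`‖f‖ ≥ ‖b̄‖ − θ`, and the disc has area `πR²`). [folklore] -/
theorem norm_mean_le_of_planar {f : EuclideanSpace ℝ (Fin 3) → EuclideanSpace ℝ (Fin 3)}
    {x₀ bbar : EuclideanSpace ℝ (Fin 3)} {R θ M : ℝ} (hR : 0 < R) (hM : 0 ≤ M)
    (hosc : ∀ x ∈ ball x₀ R, ‖f x - bbar‖ ≤ θ)
    (hpl : ∫⁻ y : EuclideanSpace ℝ (Fin 2),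
      ‖f (WithLp.toLp 2 ![y 0, y 1, x₀ 2])‖ₑ ^ 2 ≤ ENNReal.ofReal M) :
    ‖bbar‖ ≤ θ + Real.sqrt (M / π) / R := by
  by_contra hlt
  push Not at hlt
  have hpos : 0 < ‖bbar‖ - θ := by
    have : 0 ≤ Real.sqrt (M / π) / R := by positivity
    linarith
  -- the disc of radius `R` in the parameter plane
  set c2 : EuclideanSpace ℝ (Fin 2) := WithLp.toLp 2 ![x₀ 0, x₀ 1] with hc2_def
  have hdisc : ∀ y ∈ ball c2 R,
      (WithLp.toLp 2 ![y 0, y 1, x₀ 2] : EuclideanSpace ℝ (Fin 3)) ∈ ball x₀ R := by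
    intro y hy
    rw [mem_ball_iff_norm] at hy ⊢
    have h : ‖(WithLp.toLp 2 ![y 0, y 1, x₀ 2] : EuclideanSpace ℝ (Fin 3)) - x₀‖ = ‖y - c2‖ := by
      rw [EuclideanSpace.norm_eq, EuclideanSpace.norm_eq, Fin.sum_univ_three, Fin.sum_univ_two]
      have e0 : ((WithLp.toLp 2 ![y 0, y 1, x₀ 2] : EuclideanSpace ℝ (Fin 3)) - x₀) 0 =
          y 0 - x₀ 0 := rfl
      have e1 : ((WithLp.toLp 2 ![y 0, y 1, x₀ 2] : EuclideanSpace ℝ (Fin 3)) - x₀) 1 =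
          y 1 - x₀ 1 := rfl
      have e2 : ((WithLp.toLp 2 ![y 0, y 1, x₀ 2] : EuclideanSpace ℝ (Fin 3)) - x₀) 2 =
          x₀ 2 - x₀ 2 := rfl
      have f0 : (y - c2) 0 = y 0 - x₀ 0 := rfl
      have f1 : (y - c2) 1 = y 1 - x₀ 1 := rfl
      rw [e0, e1, e2, f0, f1, sub_self, norm_zero]
      ring_nf
    rw [h]
    exact hy
  -- pointwise lower bound on the disc
  have hlow : ∀ y ∈ ball c2 R, ENNReal.ofReal ((‖bbar‖ - θ) ^ 2) ≤
      ‖f (WithLp.toLp 2 ![y 0, y 1, x₀ 2])‖ₑ ^ 2 := by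
    intro y hy
    have h1 : ‖bbar‖ - θ ≤ ‖f (WithLp.toLp 2 ![y 0, y 1, x₀ 2])‖ := by
      have h2 := hosc _ (hdisc y hy)
      have h3 := norm_sub_norm_le bbar (f (WithLp.toLp 2 ![y 0, y 1, x₀ 2]))
      rw [norm_sub_rev] at h2
      linarith
    rw [← ofReal_norm, ← ENNReal.ofReal_pow (norm_nonneg _)]
    exact ENNReal.ofReal_le_ofReal (pow_le_pow_left₀ hpos.le h1 2)
  set g : EuclideanSpace ℝ (Fin 2) → ℝ≥0∞ := fun y => ‖f (WithLp.toLp 2 ![y 0, y 1, x₀ 2])‖ₑ ^ 2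
    with hg_def
  have hvol : volume (ball c2 R) = ENNReal.ofReal (R ^ 2 * π) := by
    rw [EuclideanSpace.volume_ball_fin_two, ← ENNReal.ofReal_pow hR.le,
      ← ENNReal.ofReal_mul (by positivity)]
  have hstep1 : ENNReal.ofReal ((‖bbar‖ - θ) ^ 2) * volume (ball c2 R) ≤ ∫⁻ y in ball c2 R, g y := by
    rw [← setLIntegral_const]
    exact setLIntegral_mono' measurableSet_ball hlow
  have hstep2 : ∫⁻ y in ball c2 R, g y ≤ ∫⁻ y, g y := setLIntegral_le_lintegral _ _
  have hchain : ENNReal.ofReal ((‖bbar‖ - θ) ^ 2 * (R ^ 2 * π)) ≤ ENNReal.ofReal M := by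
    rw [ENNReal.ofReal_mul (by positivity), ← hvol]
    exact hstep1.trans (hstep2.trans hpl)
  have hreal : (‖bbar‖ - θ) ^ 2 * (R ^ 2 * π) ≤ M := (ENNReal.ofReal_le_ofReal_iff hM).1 hchain
  -- hence `‖b̄‖ − θ ≤ √(M/π)/R`
  have hsq : (‖bbar‖ - θ) ^ 2 ≤ (Real.sqrt (M / π) / R) ^ 2 := by
    rw [div_pow, Real.sq_sqrt (by positivity), le_div_iff₀ (by positivity)]
    calc (‖bbar‖ - θ) ^ 2 * R ^ 2 = (‖bbar‖ - θ) ^ 2 * (R ^ 2 * π) / π := by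
          field_simp
      _ ≤ M / π := div_le_div_of_nonneg_right hreal Real.pi_pos.le
  have hle : ‖bbar‖ - θ ≤ Real.sqrt (M / π) / R :=
    le_of_sq_le_sq hsq (by positivity)
  linarith


/-- **Stub S2 `stub_lateQuietTimes` of the crux `PlanarEnergyLiouville`, line
`mean_dissipation_sieve`: late quiet times are `A·R`-dense.** Under the crux hypotheses and the
mean local dissipation bound (the conclusion of stub S1): for every `η > 0` there are `A, R₀ > 0`
such that for all `R ≥ R₀`, all centres `x₀` and all `t₁ < 0` some `τ ∈ [t₁ − AR, t₁]` has
`‖v(τ, x)‖ ≤ η` on `B(x₀, R)`. Proof: with `ε = ε(η, G)` (`G` = KNSS gradient bound),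
`δ = ε/2`, `A = 4|C₁|/ε + 1`, Chebyshev in time on the S1 bound for the ball `B(x₀, 2R)` over
`[t₁ − AR, t₁]` gives a (KNSS-good) time `τ` with `∫_{B(x₀,2R)} ‖∇v(τ)‖² ≤ ε` (the radius
cancels); the oscillation lemma `norm_sub_average_le_of_energy` gives
`‖v(τ,x) − v̄‖ ≤ 3Gρ₀ + 2√(ε/ρ₀) ≤ η/4` on `B(x₀, R)`; the planar bound on the disc through
`x₀` gives `‖v̄‖ ≤ η/4 + √(M/π)/R ≤ 3η/4` for `R ≥ R₀`. -/
theorem stub_lateQuietTimes :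
    ∀ (v : ℝ → EuclideanSpace ℝ (Fin 3) → EuclideanSpace ℝ (Fin 3)),
      Literature.Analysis.FluidPDE.IsBoundedAncientMildSolution 1 v →
      (∀ t < 0, MeasureTheory.AEStronglyMeasurable (v t) MeasureTheory.volume) →
      ContDiffOn ℝ (⊤ : ℕ∞) (Function.uncurry v) (Set.Iio 0 ×ˢ Set.univ) →
      (∃ M : ℝ, ∀ t < 0, ∀ (R : EuclideanSpace ℝ (Fin 3) ≃ₗᵢ[ℝ] EuclideanSpace ℝ (Fin 3)) (c : ℝ),
        ∫⁻ y : EuclideanSpace ℝ (Fin 2), ‖v t (R (WithLp.toLp 2 ![y 0, y 1, c]))‖ₑ ^ 2 ≤ ENNReal.ofReal M) →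
      (∃ C₁ : ℝ, ∀ δ : ℝ, 0 < δ → ∃ R₁ : ℝ, 0 < R₁ ∧ ∀ R : ℝ, R₁ ≤ R →
        ∀ (x₀ : EuclideanSpace ℝ (Fin 3)) (T t₁ : ℝ), T < t₁ → t₁ < 0 →
          ∫⁻ t in Set.Icc T t₁, ∫⁻ x in Metric.ball x₀ R, ‖fderiv ℝ (v t) x‖ₑ ^ 2
            ≤ ENNReal.ofReal (C₁ * R + δ * (t₁ - T))) →
      ∀ η : ℝ, 0 < η → ∃ A : ℝ, 0 < A ∧ ∃ R₀ : ℝ, 0 < R₀ ∧ ∀ R : ℝ, R₀ ≤ R →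
        ∀ (x₀ : EuclideanSpace ℝ (Fin 3)) (t₁ : ℝ), t₁ < 0 →
          ∃ τ ∈ Set.Icc (t₁ - A * R) t₁, ∀ x ∈ Metric.ball x₀ R, ‖v τ x‖ ≤ η := by
  intro v hv hmeas hsm hpl hS1 η hη
  obtain ⟨M, hM⟩ := hpl
  obtain ⟨C₁, hC₁⟩ := hS1
  obtain ⟨G, hG0, hGae⟩ := exists_ae_fderiv_bound hv hmeas hsm
  -- constants
  set M' : ℝ := max M 0 with hM'_def
  have hM'0 : 0 ≤ M' := le_max_right _ _
  set ρ₀ : ℝ := η / (24 * (G + 1)) with hρ₀_def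
  have hρ₀ : 0 < ρ₀ := by positivity
  set ε : ℝ := ρ₀ * (η / 16) ^ 2 with hε_def
  have hε : 0 < ε := by positivity
  have hθ : 3 * G * ρ₀ + 2 * Real.sqrt (ε / ρ₀) ≤ η / 4 := by
    have h1 : 3 * G * ρ₀ ≤ η / 8 := by
      rw [hρ₀_def, show 3 * G * (η / (24 * (G + 1))) = (3 * G * η) / (24 * (G + 1)) by ring,
        div_le_div_iff₀ (by positivity) (by norm_num)]
      nlinarith
    have h2 : Real.sqrt (ε / ρ₀) = η / 16 := by
      rw [hε_def, mul_div_cancel_left₀ _ hρ₀.ne']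
      exact Real.sqrt_sq (by positivity)
    rw [h2]
    linarith
  obtain ⟨R₁, hR₁, hS⟩ := hC₁ (ε / 2) (by positivity)
  set A : ℝ := 4 * |C₁| / ε + 1 with hA_def
  have hA : 0 < A := by positivity
  set R₀ : ℝ := max (max R₁ ρ₀) (2 * Real.sqrt (M' / π) / η + 1) with hR₀_def
  have hR₀ : 0 < R₀ := lt_max_of_lt_left (lt_max_of_lt_right hρ₀)
  refine ⟨A, hA, R₀, hR₀, fun R hR x₀ t₁ ht₁ => ?_⟩
  have hRpos : 0 < R := hR₀.trans_le hR
  have hR₁R : R₁ ≤ 2 * R := by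
    have : R₁ ≤ R := (le_max_left _ _).trans ((le_max_left _ _).trans hR)
    linarith
  have hρR : ρ₀ ≤ R := (le_max_right _ _).trans ((le_max_left _ _).trans hR)
  have hRM : Real.sqrt (M' / π) / R ≤ η / 2 := by
    have h1 : 2 * Real.sqrt (M' / π) / η + 1 ≤ R := (le_max_right _ _).trans hR
    rw [div_le_iff₀ hRpos]
    have h2 : 2 * Real.sqrt (M' / π) / η ≤ R := by linarith
    rw [div_le_iff₀ hη] at h2
    linarith
  -- the window and the S1 bound on `B(x₀, 2R)`
  set T : ℝ := t₁ - A * R with hT_def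
  have hT : T < t₁ := by rw [hT_def]; nlinarith
  have hwin : ∫⁻ t in Icc T t₁, ∫⁻ x in ball x₀ (2 * R), ‖fderiv ℝ (v t) x‖ₑ ^ 2 ≤
      ENNReal.ofReal (C₁ * (2 * R) + ε / 2 * (t₁ - T)) := hS (2 * R) hR₁R x₀ T t₁ hT ht₁
  -- Chebyshev in time, inside the KNSS-good set of times
  have hgood : ∀ᵐ t ∂((volume : Measure ℝ).restrict (Icc T t₁)), ∀ x, ‖fderiv ℝ (v t) x‖ ≤ G :=
    ae_restrict_of_ae_restrict_of_subset (Icc_subset_Iio_iff hT.le |>.2 ht₁) hGae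
  have hτ : ∃ τ ∈ Icc T t₁, (∀ x, ‖fderiv ℝ (v τ) x‖ ≤ G) ∧
      ∫⁻ x in ball x₀ (2 * R), ‖fderiv ℝ (v τ) x‖ₑ ^ 2 ≤ ENNReal.ofReal ε := by
    by_contra hno
    push Not at hno
    have hae : ∀ᵐ t ∂((volume : Measure ℝ).restrict (Icc T t₁)),
        ENNReal.ofReal ε ≤ ∫⁻ x in ball x₀ (2 * R), ‖fderiv ℝ (v t) x‖ₑ ^ 2 := by
      filter_upwards [hgood, ae_restrict_mem measurableSet_Icc] with t ht htI
      exact (hno t htI ht).le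
    have hlow : ENNReal.ofReal (ε * (t₁ - T)) ≤
        ∫⁻ t in Icc T t₁, ∫⁻ x in ball x₀ (2 * R), ‖fderiv ℝ (v t) x‖ₑ ^ 2 := by
      calc ENNReal.ofReal (ε * (t₁ - T)) = ∫⁻ t in Icc T t₁, ENNReal.ofReal ε := by
            rw [setLIntegral_const, Real.volume_Icc, ENNReal.ofReal_mul hε.le]
        _ ≤ _ := lintegral_mono_ae hae
    have hcomp := (ENNReal.ofReal_le_ofReal_iff'.1 (hlow.trans hwin)).resolve_right
      (not_le.2 (by nlinarith))
    -- `ε A R ≤ 2 C₁ R + (ε/2) A R` is impossible for `A = 4|C₁|/ε + 1`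
    have hAR : t₁ - T = A * R := by rw [hT_def]; ring
    rw [hAR] at hcomp
    have hC : C₁ ≤ |C₁| := le_abs_self C₁
    have hεA : ε * A = 4 * |C₁| + ε := by rw [hA_def]; field_simp
    nlinarith [mul_pos hε hRpos, mul_nonneg (abs_nonneg C₁) hRpos.le]
  obtain ⟨τ, hτI, hGτ, hDτ⟩ := hτ
  have hτneg : τ < 0 := hτI.2.trans_lt ht₁
  refine ⟨τ, ?_, fun x hx => ?_⟩
  · simpa [hT_def] using hτI
  -- oscillation on `B(x₀, R)` at the quiet time
  have hf : ContDiff ℝ 1 (v τ) := ParabolicGaldiLiouville.Birth.LpsOfSobolev.contDiff_slice hsm hτneg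
  have hosc : ∀ x ∈ ball x₀ R, ‖v τ x - ⨍ y in ball x₀ (2 * R), v τ y‖ ≤ η / 4 :=
    fun x hx => (norm_sub_average_le_of_energy hf hG0 hGτ hε.le hρ₀ hρR hDτ hx).trans hθ
  -- the mean is small by the planar bound on the disc through `x₀`
  have hplτ : ∫⁻ y : EuclideanSpace ℝ (Fin 2),
      ‖v τ (WithLp.toLp 2 ![y 0, y 1, x₀ 2])‖ₑ ^ 2 ≤ ENNReal.ofReal M' := by
    have h := hM τ hτneg (LinearIsometryEquiv.refl ℝ (EuclideanSpace ℝ (Fin 3))) (x₀ 2)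
    simp only [LinearIsometryEquiv.coe_refl, id_eq] at h
    exact h.trans (ENNReal.ofReal_le_ofReal (le_max_left _ _))
  have hmean : ‖⨍ y in ball x₀ (2 * R), v τ y‖ ≤ η / 4 + Real.sqrt (M' / π) / R :=
    norm_mean_le_of_planar hRpos hM'0 hosc hplτ
  calc ‖v τ x‖ = ‖(v τ x - ⨍ y in ball x₀ (2 * R), v τ y) + ⨍ y in ball x₀ (2 * R), v τ y‖ := by
        rw [sub_add_cancel]
    _ ≤ ‖v τ x - ⨍ y in ball x₀ (2 * R), v τ y‖ + ‖⨍ y in ball x₀ (2 * R), v τ y‖ :=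
        norm_add_le _ _
    _ ≤ η / 4 + (η / 4 + Real.sqrt (M' / π) / R) := add_le_add (hosc x hx) hmean
    _ ≤ η := by linarith

end Summit.NavierStokesRegularity.NavierStokesRegularity.Theorems.PlaneEnergyCeilingPlanarEnergyLiouville

end
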